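import Summits.ResolutionOfSingularities.ResolutionOfSingularities.Theorems.RisoStrataRtdLocalPad
import Summits.ResolutionOfSingularities.ResolutionOfSingularities.Theorems.RisoStrataRtdLocalCollapse
import Summits.ResolutionOfSingularities.ResolutionOfSingularities.Theorems.RisoStrataRtdLocalGl
import Summits.ResolutionOfSingularities.ResolutionOfSingularities.Theorems.RisoStrataRtdLocalSqDominated
import Summits.ResolutionOfSingularities.ResolutionOfSingularities.Theorems.RisoStrataRtdLocalCotangentSpan
import Summits.ResolutionOfSingularities.ResolutionOfSingularities.Theorems.RisoStrataRtdLocalArcEquiv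

/-!
# Crux `RtdLocal` (stmt-ResolutionOfSingularities-18840), line `Sketch`: COTANGENT INVARIANCE

Route `ResolutionOfSingularities/RisoStrata`. The typed riso-triviality predicate of the route
(clauses (1) rv-straightening, (2) positivity, (3) `W`-translation invariance, written INLINE
throughout — no definitions) evaluated on the arcs of ONE `k`-algebra `A` centred at a proper
ideal `n` does not depend on the finite family of coordinates used, as long as that family lies
in `n` and spans `n/n²`: for a presentation `g ⊆ n` of `A` and any family `p ⊆ n` with
`g ≡ N p (mod n²)` (constant matrix `N`), `Rtd(T g) r ↔ Rtd(T p) r` (`stub_invariance`, the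
lead stub of the line; typed Monreal arXiv:2606.12554 Prop 4.2 / Lemma 3.21 / Prop 4.4).

Proof = the five moves PAD ∘ SHEAR ∘ SWAP ∘ SHEAR ∘ COLLAPSE (`inv_chain`) on the landed stubs
`stub_pad`, `stub_gl`, `stub_collapse`, with the two domination inputs: `n²` is strictly
dominated by the presentation `g` (`stub_sq_dominated`) and hence by `p` (`inv_dom_span`:
`v(Δg_j) = v(Σ N Δp + Δq)` forces some `v(Δp_j') ≤ v(Δg_j)`).
-/

set_option linter.dupNamespace false

namespace Summit.ResolutionOfSingularities.ResolutionOfSingularities.Theorems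

section PointSet

variable {k : Type} [Field k]

/-- Reindexing the coordinates along `e : J ≃ J₂` preserves the typed predicate
(`W ↦ W ∘ e⁻¹`, `φ ↦ φ ∘ e⁻¹`). -/
theorem inv_reindexCoords {ι J J₂ : Type} [Fintype J] [Fintype J₂] (e : J ≃ J₂)
    (c : ι → J → HahnSeries ℚ k) (r : ℕ)
    (h : ∃ W : Submodule k (J → k), r ≤ Module.finrank k W ∧
      ∃ φ : ι → J → HahnSeries ℚ k,
        (∀ a b, a ≠ b → ∃ j, ∀ i,
          (c a j - c b j).orderTop < ((φ a i - φ b i) - (c a i - c b i)).orderTop) ∧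
        (∀ a i, 0 < (φ a i).orderTop) ∧
        (∀ a (w : J → HahnSeries ℚ k), (∀ i, 0 < (w i).orderTop) →
          w ∈ Submodule.span (HahnSeries ℚ k)
            ((fun u : J → k => fun i => HahnSeries.C (u i)) '' (W : Set (J → k))) →
          ∃ b, φ b = φ a + w)) :
    ∃ W : Submodule k (J₂ → k), r ≤ Module.finrank k W ∧
      ∃ φ : ι → J₂ → HahnSeries ℚ k,
        (∀ a b, a ≠ b → ∃ j, ∀ i,
          (c a (e.symm j) - c b (e.symm j)).orderTop <
            ((φ a i - φ b i) - (c a (e.symm i) - c b (e.symm i))).orderTop) ∧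
        (∀ a i, 0 < (φ a i).orderTop) ∧
        (∀ a (w : J₂ → HahnSeries ℚ k), (∀ i, 0 < (w i).orderTop) →
          w ∈ Submodule.span (HahnSeries ℚ k)
            ((fun u : J₂ → k => fun i => HahnSeries.C (u i)) '' (W : Set (J₂ → k))) →
          ∃ b, φ b = φ a + w) := by
  obtain ⟨W, hW, φ, h1, h2, h3⟩ := h
  let F : (J → k) ≃ₗ[k] (J₂ → k) := LinearEquiv.funCongrLeft k k e.symm
  let FH : (J → HahnSeries ℚ k) ≃ₗ[HahnSeries ℚ k] (J₂ → HahnSeries ℚ k) :=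
    LinearEquiv.funCongrLeft (HahnSeries ℚ k) (HahnSeries ℚ k) e.symm
  have hF : ∀ u j₂, F u j₂ = u (e.symm j₂) := fun _ _ => rfl
  have hFH : ∀ x j₂, FH x j₂ = x (e.symm j₂) := fun _ _ => rfl
  refine ⟨W.map (F : (J → k) →ₗ[k] (J₂ → k)), ?_, fun a j₂ => φ a (e.symm j₂), ?_, ?_, ?_⟩
  · rw [LinearEquiv.finrank_map_eq]
    exact hW
  · intro a b hab
    obtain ⟨j, hj⟩ := h1 a b hab
    refine ⟨e j, fun i => ?_⟩
    rw [Equiv.symm_apply_apply]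
    exact hj (e.symm i)
  · intro a i
    exact h2 a (e.symm i)
  · intro a w hw hwspan
    have hset : ((fun u : J₂ → k => fun i => HahnSeries.C (u i)) ''
          (W.map (F : (J → k) →ₗ[k] (J₂ → k)) : Set (J₂ → k))) =
        (FH : (J → HahnSeries ℚ k) →ₗ[HahnSeries ℚ k] (J₂ → HahnSeries ℚ k)) ''
          ((fun u : J → k => fun i => HahnSeries.C (u i)) '' (W : Set (J → k))) := by
      rw [Submodule.map_coe, Set.image_image, Set.image_image]
      rfl
    rw [hset, Submodule.span_image] at hwspan
    obtain ⟨w₀, hw₀, hw₀w⟩ := hwspan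
    have hw₀' : ∀ i, 0 < (w₀ i).orderTop := by
      intro i
      have := hw (e i)
      rw [← hw₀w] at this
      change 0 < (FH w₀ (e i)).orderTop at this
      rwa [hFH, Equiv.symm_apply_apply] at this
    obtain ⟨b, hb⟩ := h3 a w₀ hw₀' hw₀
    refine ⟨b, ?_⟩
    funext j₂
    rw [← hw₀w]
    change φ b (e.symm j₂) = φ a (e.symm j₂) + FH w₀ j₂
    rw [hb, hFH, Pi.add_apply]

/-- Swapping the two blocks preserves the typed predicate. -/
theorem inv_swap {ι J J' : Type} [Fintype J] [Fintype J']
    (c : ι → J → HahnSeries ℚ k) (d : ι → J' → HahnSeries ℚ k) (r : ℕ)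
    (h : ∃ W : Submodule k (J ⊕ J' → k), r ≤ Module.finrank k W ∧
      ∃ φ : ι → J ⊕ J' → HahnSeries ℚ k,
        (∀ a b, a ≠ b → ∃ j, ∀ i,
          (Sum.elim (c a) (d a) j - Sum.elim (c b) (d b) j).orderTop <
            ((φ a i - φ b i) - (Sum.elim (c a) (d a) i - Sum.elim (c b) (d b) i)).orderTop) ∧
        (∀ a i, 0 < (φ a i).orderTop) ∧
        (∀ a (w : J ⊕ J' → HahnSeries ℚ k), (∀ i, 0 < (w i).orderTop) →
          w ∈ Submodule.span (HahnSeries ℚ k)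
            ((fun u : J ⊕ J' → k => fun i => HahnSeries.C (u i)) '' (W : Set (J ⊕ J' → k))) →
          ∃ b, φ b = φ a + w)) :
    ∃ W : Submodule k (J' ⊕ J → k), r ≤ Module.finrank k W ∧
      ∃ φ : ι → J' ⊕ J → HahnSeries ℚ k,
        (∀ a b, a ≠ b → ∃ j, ∀ i,
          (Sum.elim (d a) (c a) j - Sum.elim (d b) (c b) j).orderTop <
            ((φ a i - φ b i) - (Sum.elim (d a) (c a) i - Sum.elim (d b) (c b) i)).orderTop) ∧
        (∀ a i, 0 < (φ a i).orderTop) ∧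
        (∀ a (w : J' ⊕ J → HahnSeries ℚ k), (∀ i, 0 < (w i).orderTop) →
          w ∈ Submodule.span (HahnSeries ℚ k)
            ((fun u : J' ⊕ J → k => fun i => HahnSeries.C (u i)) '' (W : Set (J' ⊕ J → k))) →
          ∃ b, φ b = φ a + w) := by
  have key : ∀ (a : ι) (j : J' ⊕ J),
      Sum.elim (c a) (d a) ((Equiv.sumComm J J').symm j) = Sum.elim (d a) (c a) j := by
    intro a j
    cases j <;> rfl
  have h' := inv_reindexCoords (Equiv.sumComm J J') (fun a => Sum.elim (c a) (d a)) r h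
  simp only [key] at h'
  exact h'

/-- SHEAR: adding a CONSTANT-matrix multiple of the first block to the second block preserves
the typed predicate (`stub_gl` with the unipotent block matrix `[[1, 0], [N, 1]]`). -/
theorem inv_shear {ι J J' : Type} [Fintype J] [Fintype J']
    (c : ι → J → HahnSeries ℚ k) (d d' : ι → J' → HahnSeries ℚ k) (N : Matrix J' J k)
    (hd' : ∀ a i, d' a i = d a i + (N.map HahnSeries.C).mulVec (c a) i) (r : ℕ)
    (h : ∃ W : Submodule k (J ⊕ J' → k), r ≤ Module.finrank k W ∧
      ∃ φ : ι → J ⊕ J' → HahnSeries ℚ k,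
        (∀ a b, a ≠ b → ∃ j, ∀ i,
          (Sum.elim (c a) (d a) j - Sum.elim (c b) (d b) j).orderTop <
            ((φ a i - φ b i) - (Sum.elim (c a) (d a) i - Sum.elim (c b) (d b) i)).orderTop) ∧
        (∀ a i, 0 < (φ a i).orderTop) ∧
        (∀ a (w : J ⊕ J' → HahnSeries ℚ k), (∀ i, 0 < (w i).orderTop) →
          w ∈ Submodule.span (HahnSeries ℚ k)
            ((fun u : J ⊕ J' → k => fun i => HahnSeries.C (u i)) '' (W : Set (J ⊕ J' → k))) →
          ∃ b, φ b = φ a + w)) :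
    ∃ W : Submodule k (J ⊕ J' → k), r ≤ Module.finrank k W ∧
      ∃ φ : ι → J ⊕ J' → HahnSeries ℚ k,
        (∀ a b, a ≠ b → ∃ j, ∀ i,
          (Sum.elim (c a) (d' a) j - Sum.elim (c b) (d' b) j).orderTop <
            ((φ a i - φ b i) - (Sum.elim (c a) (d' a) i - Sum.elim (c b) (d' b) i)).orderTop) ∧
        (∀ a i, 0 < (φ a i).orderTop) ∧
        (∀ a (w : J ⊕ J' → HahnSeries ℚ k), (∀ i, 0 < (w i).orderTop) →
          w ∈ Submodule.span (HahnSeries ℚ k)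
            ((fun u : J ⊕ J' → k => fun i => HahnSeries.C (u i)) '' (W : Set (J ⊕ J' → k))) →
          ∃ b, φ b = φ a + w) := by
  classical
  let M : Matrix (J ⊕ J') (J ⊕ J') k := Matrix.fromBlocks 1 0 N 1
  have hM : IsUnit M.det := by
    simp [M]
  have key : ∀ a, (M.map HahnSeries.C).mulVec (Sum.elim (c a) (d a)) =
      Sum.elim (c a) (d' a) := by
    intro a
    have h0 : (0 : Matrix J J' k).map HahnSeries.C = (0 : Matrix J J' (HahnSeries ℚ k)) := by
      ext i j
      simp
    have h1 : (1 : Matrix J J k).map HahnSeries.C = (1 : Matrix J J (HahnSeries ℚ k)) :=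
      Matrix.map_one _ (map_zero _) (map_one _)
    have h1' : (1 : Matrix J' J' k).map HahnSeries.C = (1 : Matrix J' J' (HahnSeries ℚ k)) :=
      Matrix.map_one _ (map_zero _) (map_one _)
    rw [Matrix.fromBlocks_map, Matrix.fromBlocks_mulVec, h0, h1, h1', Sum.elim_comp_inl,
      Sum.elim_comp_inr, Matrix.one_mulVec, Matrix.zero_mulVec, Matrix.one_mulVec, add_zero]
    congr 1
    funext i
    rw [hd', Pi.add_apply, add_comm]
  have hgl := stub_gl (fun a => Sum.elim (c a) (d a)) M hM r h
  simp only [key] at hgl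
  exact hgl

/-- If `x = Σ_j' C(N_j') y_j' + q` with `v(x) < v(q)`, then some `v(y_j') ≤ v(x)`
(ultrametric inequality: constants do not lower orders). -/
theorem inv_exists_le_of_eq_sum {J' : Type} [Fintype J'] (x q : HahnSeries ℚ k)
    (y : J' → HahnSeries ℚ k) (N : J' → k)
    (hx : x = ∑ j', HahnSeries.C (N j') * y j' + q) (hq : x.orderTop < q.orderTop) :
    ∃ j', (y j').orderTop ≤ x.orderTop := by
  by_contra hcon
  have hall : ∀ j', x.orderTop < (y j').orderTop := fun j' =>
    lt_of_not_ge fun h => hcon ⟨j', h⟩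
  have hμ : x.orderTop ≠ ⊤ := ne_top_of_lt hq
  have hsum : x.orderTop < (∑ j', HahnSeries.C (N j') * y j').orderTop :=
    gl_lt_orderTop_sum _ _ _ hμ fun j' _ => by
      rw [HahnSeries.C_mul_eq_smul]
      exact (hall j').trans_le (HahnSeries.orderTop_le_orderTop_smul _ _)
  have : x.orderTop < x.orderTop := by
    conv_rhs => rw [hx]
    exact (lt_min hsum hq).trans_le HahnSeries.min_orderTop_le_orderTop_add
  exact lt_irrefl _ this

/-- The five-move CHAIN (pad ∘ shear ∘ swap ∘ shear ∘ collapse): if `y = q₁ + N₁ x` with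
`q₁` strictly dominated by `x`, and `q₂ = x - N₂ y` is strictly dominated by `y`, then the typed
predicate passes from the coordinates `x` to the coordinates `y`. -/
theorem inv_chain {ι J J' : Type} [Fintype J] [Fintype J'] [Nonempty ι]
    (x : ι → J → HahnSeries ℚ k) (y : ι → J' → HahnSeries ℚ k)
    (q₁ : ι → J' → HahnSeries ℚ k) (q₂ : ι → J → HahnSeries ℚ k)
    (N₁ : Matrix J' J k) (N₂ : Matrix J J' k)
    (hq₁ : ∀ a i, y a i = q₁ a i + (N₁.map HahnSeries.C).mulVec (x a) i)
    (hq₂ : ∀ a j, q₂ a j = x a j + ((-N₂).map HahnSeries.C).mulVec (y a) j)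
    (hdom₁ : ∀ a b, a ≠ b → ∃ j, ∀ i, (x a j - x b j).orderTop < (q₁ a i - q₁ b i).orderTop)
    (hdom₂ : ∀ a b, a ≠ b → ∃ j, ∀ i, (y a j - y b j).orderTop < (q₂ a i - q₂ b i).orderTop)
    (r : ℕ)
    (h : ∃ W : Submodule k (J → k), r ≤ Module.finrank k W ∧
      ∃ φ : ι → J → HahnSeries ℚ k,
        (∀ a b, a ≠ b → ∃ j, ∀ i,
          (x a j - x b j).orderTop < ((φ a i - φ b i) - (x a i - x b i)).orderTop) ∧
        (∀ a i, 0 < (φ a i).orderTop) ∧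
        (∀ a (w : J → HahnSeries ℚ k), (∀ i, 0 < (w i).orderTop) →
          w ∈ Submodule.span (HahnSeries ℚ k)
            ((fun u : J → k => fun i => HahnSeries.C (u i)) '' (W : Set (J → k))) →
          ∃ b, φ b = φ a + w)) :
    ∃ W : Submodule k (J' → k), r ≤ Module.finrank k W ∧
      ∃ φ : ι → J' → HahnSeries ℚ k,
        (∀ a b, a ≠ b → ∃ j, ∀ i,
          (y a j - y b j).orderTop < ((φ a i - φ b i) - (y a i - y b i)).orderTop) ∧
        (∀ a i, 0 < (φ a i).orderTop) ∧
        (∀ a (w : J' → HahnSeries ℚ k), (∀ i, 0 < (w i).orderTop) →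
          w ∈ Submodule.span (HahnSeries ℚ k)
            ((fun u : J' → k => fun i => HahnSeries.C (u i)) '' (W : Set (J' → k))) →
          ∃ b, φ b = φ a + w) := by
  have h1 := stub_pad x q₁ hdom₁ r h
  have h2 := inv_shear x q₁ y N₁ hq₁ r h1
  have h3 := inv_swap x y r h2
  have h4 := inv_shear y x q₂ (-N₂) hq₂ r h3
  exact stub_collapse y q₂ hdom₂ r h4

end PointSet

section Algebra

variable {k : Type} [Field k] {A : Type} [CommRing A] [Algebra k A]

/-- Arcs are `k`-linear: they turn a `k`-combination of elements into the corresponding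
`C`-combination of values. -/
theorem inv_arc_sub_sum (a : A →ₐ[k] HahnSeries ℚ k) {J' : Type} [Fintype J'] (z : A)
    (N : J' → k) (p : J' → A) :
    a (z - ∑ j', algebraMap k A (N j') * p j') =
      a z - ∑ j', HahnSeries.C (N j') * a (p j') := by
  simp [map_sum, arcEquiv_algebraMap_eq_C]

/-- `n²` is strictly dominated by a presentation `g ⊆ n` on distinct centred arcs
(`stub_sq_dominated`, family form). -/
theorem inv_dom_gen (n : Ideal A) {J I : Type} [Fintype J] (g : J → A) (hg : ∀ j, g j ∈ n)
    (hgen : Algebra.adjoin k (Set.range g) = ⊤) (q : I → A) (hq : ∀ i, q i ∈ n ^ 2)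
    (a b : {α : A →ₐ[k] HahnSeries ℚ k // ∀ x ∈ n, 0 < (α x).orderTop}) (hab : a ≠ b) :
    ∃ j, ∀ i, (a.1 (g j) - b.1 (g j)).orderTop < (a.1 (q i) - b.1 (q i)).orderTop := by
  obtain ⟨j, -, hj⟩ := stub_sq_dominated n g hg hgen a.1 b.1 a.2 b.2
    (fun h => hab (Subtype.ext h))
  exact ⟨j, fun i => hj _ (hq i)⟩

/-- `n²` is strictly dominated, on distinct centred arcs, by ANY family `p ⊆ n` that spans
`n/n²` (i.e. such that a presentation `g` is `≡ N p (mod n²)`): the least `v(Δg_j)` is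
`v(Σ N Δp + Δq₀)` with `v(Δq₀)` larger, so some `v(Δp_j') ≤ v(Δg_j)`. -/
theorem inv_dom_span (n : Ideal A) {J J' I : Type} [Fintype J] [Fintype J'] (g : J → A)
    (hg : ∀ j, g j ∈ n) (hgen : Algebra.adjoin k (Set.range g) = ⊤) (p : J' → A)
    (N : J → J' → k) (hN : ∀ j, g j - ∑ j', algebraMap k A (N j j') * p j' ∈ n ^ 2)
    (q : I → A) (hq : ∀ i, q i ∈ n ^ 2)
    (a b : {α : A →ₐ[k] HahnSeries ℚ k // ∀ x ∈ n, 0 < (α x).orderTop}) (hab : a ≠ b) :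
    ∃ j', ∀ i, (a.1 (p j') - b.1 (p j')).orderTop < (a.1 (q i) - b.1 (q i)).orderTop := by
  obtain ⟨j, -, hj⟩ := stub_sq_dominated n g hg hgen a.1 b.1 a.2 b.2
    (fun h => hab (Subtype.ext h))
  have hq₀ := hj _ (hN j)
  have hx : a.1 (g j) - b.1 (g j) =
      ∑ j', HahnSeries.C (N j j') * (a.1 (p j') - b.1 (p j')) +
        (a.1 (g j - ∑ j', algebraMap k A (N j j') * p j') -
          b.1 (g j - ∑ j', algebraMap k A (N j j') * p j')) := by
    rw [inv_arc_sub_sum, inv_arc_sub_sum]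
    simp only [mul_sub, Finset.sum_sub_distrib]
    ring
  obtain ⟨j', hj'⟩ := inv_exists_le_of_eq_sum _ _ _ _ hx hq₀
  exact ⟨j', fun i => hj'.trans_lt (hj _ (hq i))⟩

/-- **COTANGENT INVARIANCE** (lead stub of line `Sketch`; typed Monreal Prop 4.2 / Lemma 3.21 /
Prop 4.4): inside one `k`-algebra `A` with arcs centred at a proper ideal `n` (at least one arc),
for a presentation `g ⊆ n` of `A` and any finite family `p ⊆ n` with `g ≡ N p (mod n²)`, the
typed riso-triviality predicate for the coordinates `g` holds iff it holds for the coordinates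
`p`. -/
theorem stub_invariance {k : Type} [Field k] {A : Type} [CommRing A] [Algebra k A]
    (n : Ideal A) (hn : n ≠ ⊤) {J J' : Type} [Fintype J] [Fintype J']
    (g : J → A) (hg : ∀ j, g j ∈ n) (hgen : Algebra.adjoin k (Set.range g) = ⊤)
    (p : J' → A) (hp : ∀ j, p j ∈ n) (N : J → J' → k)
    (hN : ∀ j, g j - ∑ j', algebraMap k A (N j j') * p j' ∈ n ^ 2)
    (hne : Nonempty {α : A →ₐ[k] HahnSeries ℚ k // ∀ x ∈ n, 0 < (α x).orderTop}) (r : ℕ) :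
    (∃ W : Submodule k (J → k), r ≤ Module.finrank k W ∧
      ∃ φ : {α : A →ₐ[k] HahnSeries ℚ k // ∀ x ∈ n, 0 < (α x).orderTop} → J → HahnSeries ℚ k,
        (∀ a b : {α : A →ₐ[k] HahnSeries ℚ k // ∀ x ∈ n, 0 < (α x).orderTop}, a ≠ b →
          ∃ j, ∀ i, (a.1 (g j) - b.1 (g j)).orderTop <
            ((φ a i - φ b i) - (a.1 (g i) - b.1 (g i))).orderTop) ∧
        (∀ a i, 0 < (φ a i).orderTop) ∧
        (∀ a (w : J → HahnSeries ℚ k), (∀ i, 0 < (w i).orderTop) →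
          w ∈ Submodule.span (HahnSeries ℚ k)
            ((fun u : J → k => fun i => HahnSeries.C (u i)) '' (W : Set (J → k))) →
          ∃ b, φ b = φ a + w)) ↔
    (∃ W : Submodule k (J' → k), r ≤ Module.finrank k W ∧
      ∃ φ : {α : A →ₐ[k] HahnSeries ℚ k // ∀ x ∈ n, 0 < (α x).orderTop} → J' → HahnSeries ℚ k,
        (∀ a b : {α : A →ₐ[k] HahnSeries ℚ k // ∀ x ∈ n, 0 < (α x).orderTop}, a ≠ b →
          ∃ j, ∀ i, (a.1 (p j) - b.1 (p j)).orderTop <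
            ((φ a i - φ b i) - (a.1 (p i) - b.1 (p i))).orderTop) ∧
        (∀ a i, 0 < (φ a i).orderTop) ∧
        (∀ a (w : J' → HahnSeries ℚ k), (∀ i, 0 < (w i).orderTop) →
          w ∈ Submodule.span (HahnSeries ℚ k)
            ((fun u : J' → k => fun i => HahnSeries.C (u i)) '' (W : Set (J' → k))) →
          ∃ b, φ b = φ a + w)) := by
  classical
  haveI := hne
  -- the converse congruence: `p ≡ N₂ g (mod n²)` (first-order expansion along `g`)
  have hN₂ : ∀ j', ∃ u : J → k, p j' - ∑ j, algebraMap k A (u j) * g j ∈ n ^ 2 :=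
    fun j' => cotspan_firstOrder_of_mem n hn g hg hgen (p j') (hp j')
  choose N₂ hN₂ using hN₂
  -- linearity of arcs on the two congruences
  have lin₁ : ∀ (a : {α : A →ₐ[k] HahnSeries ℚ k // ∀ x ∈ n, 0 < (α x).orderTop}) (j' : J'),
      a.1 (p j') = a.1 (p j' - ∑ j, algebraMap k A (N₂ j' j) * g j) +
        ((Matrix.of fun j' j => N₂ j' j).map HahnSeries.C).mulVec (fun j => a.1 (g j)) j' := by
    intro a j'
    rw [inv_arc_sub_sum]
    simp [Matrix.mulVec, dotProduct]
  have lin₂ : ∀ (a : {α : A →ₐ[k] HahnSeries ℚ k // ∀ x ∈ n, 0 < (α x).orderTop}) (j : J),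
      a.1 (g j) = a.1 (g j - ∑ j', algebraMap k A (N j j') * p j') +
        ((Matrix.of fun j j' => N j j').map HahnSeries.C).mulVec (fun j' => a.1 (p j')) j := by
    intro a j
    rw [inv_arc_sub_sum]
    simp [Matrix.mulVec, dotProduct]
  have lin₁' : ∀ (a : {α : A →ₐ[k] HahnSeries ℚ k // ∀ x ∈ n, 0 < (α x).orderTop}) (j' : J'),
      a.1 (p j' - ∑ j, algebraMap k A (N₂ j' j) * g j) = a.1 (p j') +
        ((-(Matrix.of fun j' j => N₂ j' j)).map HahnSeries.C).mulVec (fun j => a.1 (g j)) j' := by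
    intro a j'
    rw [inv_arc_sub_sum]
    simp [Matrix.mulVec, dotProduct, Finset.sum_neg_distrib, sub_eq_add_neg]
  have lin₂' : ∀ (a : {α : A →ₐ[k] HahnSeries ℚ k // ∀ x ∈ n, 0 < (α x).orderTop}) (j : J),
      a.1 (g j - ∑ j', algebraMap k A (N j j') * p j') = a.1 (g j) +
        ((-(Matrix.of fun j j' => N j j')).map HahnSeries.C).mulVec (fun j' => a.1 (p j')) j := by
    intro a j
    rw [inv_arc_sub_sum]
    simp [Matrix.mulVec, dotProduct, Finset.sum_neg_distrib, sub_eq_add_neg]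
  -- the two domination inputs
  have domG := fun (a b : {α : A →ₐ[k] HahnSeries ℚ k // ∀ x ∈ n, 0 < (α x).orderTop})
      (hab : a ≠ b) => inv_dom_gen n g hg hgen
        (fun j' => p j' - ∑ j, algebraMap k A (N₂ j' j) * g j) hN₂ a b hab
  have domP := fun (a b : {α : A →ₐ[k] HahnSeries ℚ k // ∀ x ∈ n, 0 < (α x).orderTop})
      (hab : a ≠ b) => inv_dom_span n g hg hgen p N hN
        (fun j => g j - ∑ j', algebraMap k A (N j j') * p j') hN a b hab
  constructor
  · intro h
    exact inv_chain (fun (a : {α : A →ₐ[k] HahnSeries ℚ k // ∀ x ∈ n, 0 < (α x).orderTop}) j => a.1 (g j)) (fun (a : {α : A →ₐ[k] HahnSeries ℚ k // ∀ x ∈ n, 0 < (α x).orderTop}) j' => a.1 (p j'))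
      (fun (a : {α : A →ₐ[k] HahnSeries ℚ k // ∀ x ∈ n, 0 < (α x).orderTop}) j' => a.1 (p j' - ∑ j, algebraMap k A (N₂ j' j) * g j))
      (fun (a : {α : A →ₐ[k] HahnSeries ℚ k // ∀ x ∈ n, 0 < (α x).orderTop}) j => a.1 (g j - ∑ j', algebraMap k A (N j j') * p j'))
      (Matrix.of fun j' j => N₂ j' j) (Matrix.of fun j j' => N j j') lin₁ lin₂' domG domP r h
  · intro h
    exact inv_chain (fun (a : {α : A →ₐ[k] HahnSeries ℚ k // ∀ x ∈ n, 0 < (α x).orderTop}) j' => a.1 (p j')) (fun (a : {α : A →ₐ[k] HahnSeries ℚ k // ∀ x ∈ n, 0 < (α x).orderTop}) j => a.1 (g j))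
      (fun (a : {α : A →ₐ[k] HahnSeries ℚ k // ∀ x ∈ n, 0 < (α x).orderTop}) j => a.1 (g j - ∑ j', algebraMap k A (N j j') * p j'))
      (fun (a : {α : A →ₐ[k] HahnSeries ℚ k // ∀ x ∈ n, 0 < (α x).orderTop}) j' => a.1 (p j' - ∑ j, algebraMap k A (N₂ j' j) * g j))
      (Matrix.of fun j j' => N j j') (Matrix.of fun j' j => N₂ j' j) lin₂ lin₁' domP domG r h

end Algebra

end Summit.ResolutionOfSingularities.ResolutionOfSingularities.Theorems
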